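import Mathlib
import Summits.Ventures.PercRepro2.Defs
import Summits.Ventures.PercRepro2.Independence
import Summits.Ventures.PercRepro2.Harris
import Summits.Ventures.PercRepro2.Graph
import Summits.Ventures.PercRepro2.Events
import Summits.Ventures.PercRepro2.Induced
import Summits.Ventures.PercRepro2.Frontier
import Summits.Ventures.PercRepro2.FourFunctions
import Summits.Ventures.PercRepro2.BTVFamilyDefs
import Summits.Ventures.PercRepro2.BlockConn
import Summits.Ventures.PercRepro2.BlockFamilyDefs
import Summits.Ventures.PercRepro2.BlockFamilyReveal
import Summits.Ventures.PercRepro2.BlockFamilyTower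
import Summits.Ventures.PercRepro2.BlockFamilyBase

/-!
# The block family: the theorem (blind cell PercRepro2, mine-1 g53;
paper proofs/MINE1-BLOCKS.md §2.1, §2.4)

`bfamily`: for every induced subgraph `G[U]`, every set `Vs` of observed vertices, frontier sets
`A₁, W₁, W₂ ⊆ U` and every block structure `𝒰₂` inside `U`,
`P(a(A₁,W₁)) · P(b(𝒰₂,W₂)) ≤ P(j(A₁ ∪ ⋃𝒰₂, 𝒰₂, W₁ ∩ W₂)) · P(m(A₁ ∩ ⋃𝒰₂, W₁ ∪ W₂))`.
Induction on `U` as in `BTVFamily.vfamily`: while a vertex `z` lies in a frontier set of both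
left-hand cells, the edges at `z` are revealed in both configurations and `z` is deleted; a
vertex of `A₁` and of a block is a block vertex of the join and a frontier vertex of the meet —
four functions with `j` at `ξ ⊔ ξ'` (the merged block gains both revealed sets, (F2′)) and
`m` at `ξ ⊓ ξ'`; a vertex of `W₁ ∩ W₂` the reversed orientation; a vertex of `A₁ ∩ W₂` is FREE
in the join, where the glue (F2″) replaces the tower identity; a vertex of `W₁` and of a block
the swap pairing.  With no such vertex left, `BlockFamilyBase.bfamily_base` applies.
-/

namespace Summit.Ventures.PercRepro2

namespace BlockFamily

open BTVFamily

section Main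

variable {V : Type*} {E : Type*} [Fintype E] [DecidableEq E] [Fintype V] [DecidableEq V]
  {R : Type*} [CommRing R] [LinearOrder R] [IsStrictOrderedRing R]

omit [Fintype E] [DecidableEq E] [Fintype V] in
/-- Every block revealed with a larger set contains a block revealed with the smaller one. -/
lemma revealBlocks_mono' {𝒰 : Finset (Finset V)} {z : V} {F F' : Finset V} (h : F ⊆ F') :
    ∀ B' ∈ revealBlocks 𝒰 z F', ∃ B ∈ revealBlocks 𝒰 z F, B ⊆ B' := by
  intro B' hB'
  rcases mem_revealBlocks.1 hB' with ⟨hB', hz⟩ | rfl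
  · exact ⟨B', mem_revealBlocks_of_not_mem hB' hz F, le_rfl⟩
  · exact ⟨_, mergedBlock_mem_revealBlocks 𝒰 z F, Finset.union_subset_union_right h⟩

/-- **The block family** (paper proofs/MINE1-BLOCKS.md, Theorem 2.1): for every induced subgraph
`G[U]`, every set `Vs` of observed vertices, frontier sets `A₁, W₁, W₂ ⊆ U` and every block
structure `𝒰₂` inside `U`,
`P(a(A₁,W₁)) P(b(𝒰₂,W₂)) ≤ P(j(A₁ ∪ ⋃𝒰₂, 𝒰₂, W₁ ∩ W₂)) P(m(A₁ ∩ ⋃𝒰₂, W₁ ∪ W₂))`. -/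
theorem bfamily (p : E → R) (hp : IsProbVec p) (ends : E → Sym2 V) (s t : V) (Vs : Finset V)
    (U : Finset V) :
    ∀ (A₁ W₁ : Finset V) (𝒰₂ : Finset (Finset V)) (W₂ : Finset V), A₁ ⊆ U → W₁ ⊆ U →
      unionB 𝒰₂ ⊆ U → W₂ ⊆ U →
      prob p (aEv ends U s t Vs A₁ W₁) * prob p (bEv ends U s t Vs 𝒰₂ W₂) ≤
        prob p (jEv ends U s t Vs (A₁ ∪ unionB 𝒰₂) 𝒰₂ (W₁ ∩ W₂)) *
          prob p (mEv ends U s t Vs (A₁ ∩ unionB 𝒰₂) (W₁ ∪ W₂)) := by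
  induction U using Finset.strongInduction with
  | H U ih =>
  intro A₁ W₁ 𝒰₂ W₂ hA₁ hW₁ hA₂ hW₂
  have hR : 0 ≤ prob p (jEv ends U s t Vs (A₁ ∪ unionB 𝒰₂) 𝒰₂ (W₁ ∩ W₂)) *
      prob p (mEv ends U s t Vs (A₁ ∩ unionB 𝒰₂) (W₁ ∪ W₂)) :=
    mul_nonneg (prob_nonneg hp _) (prob_nonneg hp _)
  by_cases hZ : (A₁ ∪ W₁) ∩ (unionB 𝒰₂ ∪ W₂) = ∅
  · exact bfamily_base p hp ends s t U Vs A₁ W₁ 𝒰₂ W₂ hZ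
  obtain ⟨z, hz⟩ := Finset.nonempty_iff_ne_empty.2 hZ
  obtain ⟨hz1, hz2⟩ := Finset.mem_inter.1 hz
  -- degenerate cases: a terminal, an observed vertex, or an overlap in the common frontier
  by_cases hzs : z = s
  · subst hzs
    rw [aEv_eq_empty_of_mem_s hz1, prob_empty, zero_mul]
    exact hR
  by_cases hzv : z ∈ Vs
  · rw [aEv_eq_empty_of_mem_v hzv hz1, prob_empty, zero_mul]
    exact hR
  by_cases hzt : z = t
  · subst hzt
    rw [bEv_eq_empty_of_mem_t hz2, prob_empty, mul_zero]
    exact hR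
  by_cases hov1 : z ∈ A₁ ∧ z ∈ W₁
  · rw [aEv_eq_empty_of_overlap hov1.1 hov1.2, prob_empty, zero_mul]
    exact hR
  by_cases hov2 : z ∈ unionB 𝒰₂ ∧ z ∈ W₂
  · rw [bEv_eq_empty_of_overlap hov2.1 hov2.2, prob_empty, mul_zero]
    exact hR
  -- the exploration step at `z`
  have hzU : z ∈ U := (Finset.mem_union.1 hz1).elim (fun h => hA₁ h) (fun h => hW₁ h)
  have hU' : U \ {z} ⊂ U := Finset.sdiff_ssubset (Finset.singleton_subset_iff.2 hzU)
    (Finset.singleton_nonempty z)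
  have hsub : ∀ {X : Finset V}, X ⊆ U → X.erase z ⊆ U \ {z} := fun {X} hX x hx => by
    rw [Finset.mem_sdiff, Finset.mem_singleton]
    exact ⟨hX (Finset.mem_of_mem_erase hx), Finset.ne_of_mem_erase hx⟩
  have hsub' : ∀ {X : Finset V}, X ⊆ U → z ∉ X → X ⊆ U \ {z} := fun {X} hX hzX x hx => by
    rw [Finset.mem_sdiff, Finset.mem_singleton]
    exact ⟨hX hx, fun h => hzX (h ▸ hx)⟩
  have hfr : ∀ ω : Config E, frontier ends U {z} ω ⊆ U \ {z} := fun ω => frontier_subset ω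
  have hrev : ∀ ω : Config E, unionB (revealBlocks 𝒰₂ z (frontier ends U {z} ω)) ⊆ U \ {z} :=
    fun ω => by
      rw [unionB_revealBlocks]
      exact Finset.union_subset (hsub hA₂) (hfr ω)
  have hnn : ∀ (X : Set (Config E)) (ω : Config E), 0 ≤ weight p ω * prob p X :=
    fun X ω => mul_nonneg (weight_nonneg hp ω) (prob_nonneg hp X)
  rcases Finset.mem_union.1 hz1 with hzA₁ | hzW₁ <;> rcases Finset.mem_union.1 hz2 with hzA₂ | hzW₂
  · -- (i) `z ∈ A₁` and `z` in a block: four functions, `j` at `ξ ⊔ ξ'`, `m` at `ξ ⊓ ξ'`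
    have hzW₁ : z ∉ W₁ := fun h => hov1 ⟨hzA₁, h⟩
    have hzW₂ : z ∉ W₂ := fun h => hov2 ⟨hzA₂, h⟩
    rw [prob_aEv_reveal_A p ends hzU hzs hzt hzA₁ hzW₁, prob_bEv_reveal_A p ends hzU hzs hzt hzA₂ hzW₂,
      prob_jEv_reveal_A p ends hzU hzs hzt hzv (Finset.mem_union_left _ hzA₁) hzA₂
        (fun h => hzW₁ (Finset.mem_inter.1 h).1),
      prob_mEv_reveal_A p ends hzU hzs hzt (Finset.mem_inter.2 ⟨hzA₁, hzA₂⟩)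
        (fun h => (Finset.mem_union.1 h).elim hzW₁ hzW₂),
      mul_comm (∑ ω, weight p ω * prob p (jEv _ _ _ _ _ _ _ _))]
    refine four_functions_theorem_univ
      (fun ω => weight p ω * prob p (aEv ends (U \ {z}) s t Vs (A₁.erase z ∪ frontier ends U {z} ω) W₁))
      (fun ω => weight p ω * prob p (bEv ends (U \ {z}) s t Vs
        (revealBlocks 𝒰₂ z (frontier ends U {z} ω)) W₂))
      (fun ω => weight p ω * prob p (mEv ends (U \ {z}) s t Vs
        ((A₁ ∩ unionB 𝒰₂).erase z ∪ frontier ends U {z} ω) (W₁ ∪ W₂)))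
      (fun ω => weight p ω * prob p (jEv ends (U \ {z}) s t Vs
        ((A₁ ∪ unionB 𝒰₂).erase z ∪ frontier ends U {z} ω)
        (revealBlocks 𝒰₂ z (frontier ends U {z} ω)) (W₁ ∩ W₂)))
      (fun ω => hnn _ ω) (fun ω => hnn _ ω) (fun ω => hnn _ ω) (fun ω => hnn _ ω) ?_
    intro ω ω'
    have hIH := ih (U \ {z}) hU' (A₁.erase z ∪ frontier ends U {z} ω) W₁
      (revealBlocks 𝒰₂ z (frontier ends U {z} ω')) W₂ (Finset.union_subset (hsub hA₁) (hfr ω))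
      (hsub' hW₁ hzW₁) (hrev ω') (hsub' hW₂ hzW₂)
    rw [unionB_revealBlocks] at hIH
    have e3 : (A₁.erase z ∪ frontier ends U {z} ω) ∪ ((unionB 𝒰₂).erase z ∪ frontier ends U {z} ω') =
        (A₁ ∪ unionB 𝒰₂).erase z ∪ frontier ends U {z} (ω ⊔ ω') := by
      rw [frontier_sup, erase_union_union]
    have h3 : prob p (jEv ends (U \ {z}) s t Vs ((A₁ ∪ unionB 𝒰₂).erase z ∪ frontier ends U {z} (ω ⊔ ω'))
        (revealBlocks 𝒰₂ z (frontier ends U {z} ω')) (W₁ ∩ W₂)) ≤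
        prob p (jEv ends (U \ {z}) s t Vs ((A₁ ∪ unionB 𝒰₂).erase z ∪ frontier ends U {z} (ω ⊔ ω'))
          (revealBlocks 𝒰₂ z (frontier ends U {z} (ω ⊔ ω'))) (W₁ ∩ W₂)) := by
      refine prob_mono hp (jEv_mono_blocks _ (revealBlocks_mono ?_) (revealBlocks_mono' ?_) _)
      · rw [frontier_sup]; exact Finset.subset_union_right
      · rw [frontier_sup]; exact Finset.subset_union_right
    have h4 : prob p (mEv ends (U \ {z}) s t Vs
        ((A₁.erase z ∪ frontier ends U {z} ω) ∩ ((unionB 𝒰₂).erase z ∪ frontier ends U {z} ω'))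
        (W₁ ∪ W₂)) ≤
        prob p (mEv ends (U \ {z}) s t Vs ((A₁ ∩ unionB 𝒰₂).erase z ∪ frontier ends U {z} (ω ⊓ ω'))
          (W₁ ∪ W₂)) :=
      prob_mono hp (mEv_anti_left
        ((Finset.union_subset_union_right (frontier_inf_subset ω ω')).trans
          (erase_inter_subset A₁ (unionB 𝒰₂) _ _ z)) _)
    rw [e3] at hIH
    calc weight p ω * prob p (aEv ends (U \ {z}) s t Vs (A₁.erase z ∪ frontier ends U {z} ω) W₁) *
          (weight p ω' * prob p (bEv ends (U \ {z}) s t Vs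
            (revealBlocks 𝒰₂ z (frontier ends U {z} ω')) W₂))
        = (weight p ω * weight p ω') *
            (prob p (aEv ends (U \ {z}) s t Vs (A₁.erase z ∪ frontier ends U {z} ω) W₁) *
              prob p (bEv ends (U \ {z}) s t Vs (revealBlocks 𝒰₂ z (frontier ends U {z} ω')) W₂)) := by
          ring
      _ ≤ (weight p ω * weight p ω') *
            (prob p (jEv ends (U \ {z}) s t Vs
                ((A₁ ∪ unionB 𝒰₂).erase z ∪ frontier ends U {z} (ω ⊔ ω'))
                (revealBlocks 𝒰₂ z (frontier ends U {z} (ω ⊔ ω'))) (W₁ ∩ W₂)) *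
              prob p (mEv ends (U \ {z}) s t Vs
                ((A₁ ∩ unionB 𝒰₂).erase z ∪ frontier ends U {z} (ω ⊓ ω')) (W₁ ∪ W₂))) :=
          mul_le_mul_of_nonneg_left (hIH.trans (mul_le_mul h3 h4 (prob_nonneg hp _)
            (prob_nonneg hp _))) (mul_nonneg (weight_nonneg hp ω) (weight_nonneg hp ω'))
      _ = weight p (ω ⊓ ω') * prob p (mEv ends (U \ {z}) s t Vs
            ((A₁ ∩ unionB 𝒰₂).erase z ∪ frontier ends U {z} (ω ⊓ ω')) (W₁ ∪ W₂)) *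
          (weight p (ω ⊔ ω') * prob p (jEv ends (U \ {z}) s t Vs
            ((A₁ ∪ unionB 𝒰₂).erase z ∪ frontier ends U {z} (ω ⊔ ω'))
            (revealBlocks 𝒰₂ z (frontier ends U {z} (ω ⊔ ω'))) (W₁ ∩ W₂))) := by
          rw [← weight_inf_mul_weight_sup p ω ω']
          ring
  · -- (iii) `z ∈ A₁ ∩ W₂`: `z` is free in the join — the glue; `m` takes `ξ'`
    have hzW₁ : z ∉ W₁ := fun h => hov1 ⟨hzA₁, h⟩
    have hzA₂ : z ∉ unionB 𝒰₂ := fun h => hov2 ⟨h, hzW₂⟩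
    rw [prob_aEv_reveal_A p ends hzU hzs hzt hzA₁ hzW₁, prob_bEv_reveal_W p ends hzU hzs hzt hzA₂ hzW₂,
      Finset.sum_mul_sum]
    have hpt : ∀ ω ω' : Config E,
        weight p ω * prob p (aEv ends (U \ {z}) s t Vs (A₁.erase z ∪ frontier ends U {z} ω) W₁) *
          (weight p ω' * prob p (bEv ends (U \ {z}) s t Vs 𝒰₂ (W₂.erase z ∪ frontier ends U {z} ω'))) ≤
        weight p ω * prob p (jEv ends (U \ {z}) s t Vs
            ((A₁ ∪ unionB 𝒰₂).erase z ∪ frontier ends U {z} ω) 𝒰₂ (W₁ ∩ W₂)) *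
          (weight p ω' * prob p (mEv ends (U \ {z}) s t Vs (A₁ ∩ unionB 𝒰₂)
            ((W₁ ∪ W₂).erase z ∪ frontier ends U {z} ω'))) := by
      intro ω ω'
      have hIH := ih (U \ {z}) hU' (A₁.erase z ∪ frontier ends U {z} ω) W₁ 𝒰₂
        (W₂.erase z ∪ frontier ends U {z} ω') (Finset.union_subset (hsub hA₁) (hfr ω))
        (hsub' hW₁ hzW₁) (hsub' hA₂ hzA₂) (Finset.union_subset (hsub hW₂) (hfr ω'))
      have e3 : (A₁.erase z ∪ frontier ends U {z} ω) ∪ unionB 𝒰₂ =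
          (A₁ ∪ unionB 𝒰₂).erase z ∪ frontier ends U {z} ω := (erase_union_right hzA₂).symm
      have e4 : W₁ ∪ (W₂.erase z ∪ frontier ends U {z} ω') =
          (W₁ ∪ W₂).erase z ∪ frontier ends U {z} ω' := (erase_union_left hzW₁).symm
      rw [e3, e4] at hIH
      have h3 : prob p (jEv ends (U \ {z}) s t Vs ((A₁ ∪ unionB 𝒰₂).erase z ∪ frontier ends U {z} ω)
          𝒰₂ (W₁ ∩ (W₂.erase z ∪ frontier ends U {z} ω'))) ≤
          prob p (jEv ends (U \ {z}) s t Vs ((A₁ ∪ unionB 𝒰₂).erase z ∪ frontier ends U {z} ω) 𝒰₂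
            (W₁ ∩ W₂)) :=
        prob_mono hp (jEv_anti_right _ _ (inter_subset_erase_union_right hzW₁))
      have h4 : prob p (mEv ends (U \ {z}) s t Vs ((A₁.erase z ∪ frontier ends U {z} ω) ∩ unionB 𝒰₂)
          ((W₁ ∪ W₂).erase z ∪ frontier ends U {z} ω')) ≤
          prob p (mEv ends (U \ {z}) s t Vs (A₁ ∩ unionB 𝒰₂)
            ((W₁ ∪ W₂).erase z ∪ frontier ends U {z} ω')) :=
        prob_mono hp (mEv_anti_left (inter_subset_erase_union_left hzA₂) _)
      calc weight p ω * prob p (aEv ends (U \ {z}) s t Vs (A₁.erase z ∪ frontier ends U {z} ω) W₁) *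
            (weight p ω' * prob p (bEv ends (U \ {z}) s t Vs 𝒰₂
              (W₂.erase z ∪ frontier ends U {z} ω')))
          = (weight p ω * weight p ω') *
              (prob p (aEv ends (U \ {z}) s t Vs (A₁.erase z ∪ frontier ends U {z} ω) W₁) *
                prob p (bEv ends (U \ {z}) s t Vs 𝒰₂ (W₂.erase z ∪ frontier ends U {z} ω'))) := by
            ring
        _ ≤ (weight p ω * weight p ω') *
              (prob p (jEv ends (U \ {z}) s t Vs ((A₁ ∪ unionB 𝒰₂).erase z ∪ frontier ends U {z} ω)
                  𝒰₂ (W₁ ∩ W₂)) *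
                prob p (mEv ends (U \ {z}) s t Vs (A₁ ∩ unionB 𝒰₂)
                  ((W₁ ∪ W₂).erase z ∪ frontier ends U {z} ω'))) :=
            mul_le_mul_of_nonneg_left (hIH.trans (mul_le_mul h3 h4 (prob_nonneg hp _)
              (prob_nonneg hp _))) (mul_nonneg (weight_nonneg hp ω) (weight_nonneg hp ω'))
        _ = _ := by ring
    calc ∑ ω, ∑ ω', weight p ω *
            prob p (aEv ends (U \ {z}) s t Vs (A₁.erase z ∪ frontier ends U {z} ω) W₁) *
          (weight p ω' * prob p (bEv ends (U \ {z}) s t Vs 𝒰₂ (W₂.erase z ∪ frontier ends U {z} ω')))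
        ≤ ∑ ω, ∑ ω', weight p ω * prob p (jEv ends (U \ {z}) s t Vs
            ((A₁ ∪ unionB 𝒰₂).erase z ∪ frontier ends U {z} ω) 𝒰₂ (W₁ ∩ W₂)) *
          (weight p ω' * prob p (mEv ends (U \ {z}) s t Vs (A₁ ∩ unionB 𝒰₂)
            ((W₁ ∪ W₂).erase z ∪ frontier ends U {z} ω'))) :=
          Finset.sum_le_sum fun ω _ => Finset.sum_le_sum fun ω' _ => hpt ω ω'
      _ = (∑ ω, weight p ω * prob p (jEv ends (U \ {z}) s t Vs
            ((A₁ ∪ unionB 𝒰₂).erase z ∪ frontier ends U {z} ω) 𝒰₂ (W₁ ∩ W₂))) *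
          ∑ ω', weight p ω' * prob p (mEv ends (U \ {z}) s t Vs (A₁ ∩ unionB 𝒰₂)
            ((W₁ ∪ W₂).erase z ∪ frontier ends U {z} ω')) := (Finset.sum_mul_sum _ _ _ _).symm
      _ ≤ prob p (jEv ends U s t Vs (A₁ ∪ unionB 𝒰₂) 𝒰₂ (W₁ ∩ W₂)) *
          prob p (mEv ends U s t Vs (A₁ ∩ unionB 𝒰₂) (W₁ ∪ W₂)) := by
          refine mul_le_mul (prob_jEv_glue_le p ends hzU hzs hzt hp _ 𝒰₂
            (fun h => hzW₁ (Finset.mem_inter.1 h).1)) (le_of_eq ?_)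
            (Finset.sum_nonneg fun ω _ => hnn _ ω) (prob_nonneg hp _)
          exact (prob_mEv_reveal_W p ends hzU hzs hzt hzv (fun h => hzA₂ (Finset.mem_inter.1 h).2)
            (Finset.mem_union_right _ hzW₂)).symm
  · -- (iv) `z ∈ W₁` and `z` in a block: the swap pairing (`j` takes `ξ'`, `m` takes `ξ`)
    have hzA₁ : z ∉ A₁ := fun h => hov1 ⟨h, hzW₁⟩
    have hzW₂ : z ∉ W₂ := fun h => hov2 ⟨hzA₂, h⟩
    rw [prob_aEv_reveal_W p ends hzU hzs hzt hzA₁ hzW₁, prob_bEv_reveal_A p ends hzU hzs hzt hzA₂ hzW₂,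
      prob_jEv_reveal_A p ends hzU hzs hzt hzv (Finset.mem_union_right _ hzA₂) hzA₂
        (fun h => hzW₂ (Finset.mem_inter.1 h).2),
      prob_mEv_reveal_W p ends hzU hzs hzt hzv (fun h => hzA₁ (Finset.mem_inter.1 h).1)
        (Finset.mem_union_left _ hzW₁), mul_comm (∑ ω, weight p ω * prob p (jEv _ _ _ _ _ _ _ _)),
      Finset.sum_mul_sum, Finset.sum_mul_sum]
    refine Finset.sum_le_sum fun ω _ => Finset.sum_le_sum fun ω' _ => ?_
    have hIH := ih (U \ {z}) hU' A₁ (W₁.erase z ∪ frontier ends U {z} ω)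
      (revealBlocks 𝒰₂ z (frontier ends U {z} ω')) W₂ (hsub' hA₁ hzA₁)
      (Finset.union_subset (hsub hW₁) (hfr ω)) (hrev ω') (hsub' hW₂ hzW₂)
    rw [unionB_revealBlocks] at hIH
    have e3 : A₁ ∪ ((unionB 𝒰₂).erase z ∪ frontier ends U {z} ω') =
        (A₁ ∪ unionB 𝒰₂).erase z ∪ frontier ends U {z} ω' := (erase_union_left hzA₁).symm
    have e4 : (W₁.erase z ∪ frontier ends U {z} ω) ∪ W₂ =
        (W₁ ∪ W₂).erase z ∪ frontier ends U {z} ω := (erase_union_right hzW₂).symm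
    rw [e3, e4] at hIH
    have h3 : prob p (jEv ends (U \ {z}) s t Vs ((A₁ ∪ unionB 𝒰₂).erase z ∪ frontier ends U {z} ω')
        (revealBlocks 𝒰₂ z (frontier ends U {z} ω'))
        ((W₁.erase z ∪ frontier ends U {z} ω) ∩ W₂)) ≤
        prob p (jEv ends (U \ {z}) s t Vs ((A₁ ∪ unionB 𝒰₂).erase z ∪ frontier ends U {z} ω')
          (revealBlocks 𝒰₂ z (frontier ends U {z} ω')) (W₁ ∩ W₂)) :=
      prob_mono hp (jEv_anti_right _ _ (inter_subset_erase_union_left hzW₂))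
    have h4 : prob p (mEv ends (U \ {z}) s t Vs
        (A₁ ∩ ((unionB 𝒰₂).erase z ∪ frontier ends U {z} ω'))
        ((W₁ ∪ W₂).erase z ∪ frontier ends U {z} ω)) ≤
        prob p (mEv ends (U \ {z}) s t Vs (A₁ ∩ unionB 𝒰₂)
          ((W₁ ∪ W₂).erase z ∪ frontier ends U {z} ω)) :=
      prob_mono hp (mEv_anti_left (inter_subset_erase_union_right hzA₁) _)
    calc weight p ω * prob p (aEv ends (U \ {z}) s t Vs A₁ (W₁.erase z ∪ frontier ends U {z} ω)) *
          (weight p ω' * prob p (bEv ends (U \ {z}) s t Vs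
            (revealBlocks 𝒰₂ z (frontier ends U {z} ω')) W₂))
        = (weight p ω * weight p ω') *
            (prob p (aEv ends (U \ {z}) s t Vs A₁ (W₁.erase z ∪ frontier ends U {z} ω)) *
              prob p (bEv ends (U \ {z}) s t Vs (revealBlocks 𝒰₂ z (frontier ends U {z} ω')) W₂)) := by
          ring
      _ ≤ (weight p ω * weight p ω') *
            (prob p (jEv ends (U \ {z}) s t Vs ((A₁ ∪ unionB 𝒰₂).erase z ∪ frontier ends U {z} ω')
                (revealBlocks 𝒰₂ z (frontier ends U {z} ω')) (W₁ ∩ W₂)) *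
              prob p (mEv ends (U \ {z}) s t Vs (A₁ ∩ unionB 𝒰₂)
                ((W₁ ∪ W₂).erase z ∪ frontier ends U {z} ω))) :=
          mul_le_mul_of_nonneg_left (hIH.trans (mul_le_mul h3 h4 (prob_nonneg hp _)
            (prob_nonneg hp _))) (mul_nonneg (weight_nonneg hp ω) (weight_nonneg hp ω'))
      _ = weight p ω * prob p (mEv ends (U \ {z}) s t Vs (A₁ ∩ unionB 𝒰₂)
            ((W₁ ∪ W₂).erase z ∪ frontier ends U {z} ω)) *
          (weight p ω' * prob p (jEv ends (U \ {z}) s t Vs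
            ((A₁ ∪ unionB 𝒰₂).erase z ∪ frontier ends U {z} ω')
            (revealBlocks 𝒰₂ z (frontier ends U {z} ω')) (W₁ ∩ W₂))) := by ring
  · -- (ii) `z ∈ W₁ ∩ W₂`: four functions with the orientation reversed
    have hzA₁ : z ∉ A₁ := fun h => hov1 ⟨h, hzW₁⟩
    have hzA₂ : z ∉ unionB 𝒰₂ := fun h => hov2 ⟨h, hzW₂⟩
    rw [prob_aEv_reveal_W p ends hzU hzs hzt hzA₁ hzW₁, prob_bEv_reveal_W p ends hzU hzs hzt hzA₂ hzW₂,
      prob_jEv_reveal_W p ends hzU hzs hzt Finset.subset_union_right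
        (fun h => (Finset.mem_union.1 h).elim hzA₁ hzA₂) (Finset.mem_inter.2 ⟨hzW₁, hzW₂⟩),
      prob_mEv_reveal_W p ends hzU hzs hzt hzv (fun h => hzA₁ (Finset.mem_inter.1 h).1)
        (Finset.mem_union_left _ hzW₁)]
    refine four_functions_theorem_univ
      (fun ω => weight p ω * prob p (aEv ends (U \ {z}) s t Vs A₁ (W₁.erase z ∪ frontier ends U {z} ω)))
      (fun ω => weight p ω * prob p (bEv ends (U \ {z}) s t Vs 𝒰₂ (W₂.erase z ∪ frontier ends U {z} ω)))
      (fun ω => weight p ω * prob p (jEv ends (U \ {z}) s t Vs (A₁ ∪ unionB 𝒰₂) 𝒰₂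
        ((W₁ ∩ W₂).erase z ∪ frontier ends U {z} ω)))
      (fun ω => weight p ω * prob p (mEv ends (U \ {z}) s t Vs (A₁ ∩ unionB 𝒰₂)
        ((W₁ ∪ W₂).erase z ∪ frontier ends U {z} ω)))
      (fun ω => hnn _ ω) (fun ω => hnn _ ω) (fun ω => hnn _ ω) (fun ω => hnn _ ω) ?_
    intro ω ω'
    have hIH := ih (U \ {z}) hU' A₁ (W₁.erase z ∪ frontier ends U {z} ω) 𝒰₂
      (W₂.erase z ∪ frontier ends U {z} ω') (hsub' hA₁ hzA₁)
      (Finset.union_subset (hsub hW₁) (hfr ω)) (hsub' hA₂ hzA₂)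
      (Finset.union_subset (hsub hW₂) (hfr ω'))
    have e4 : (W₁.erase z ∪ frontier ends U {z} ω) ∪ (W₂.erase z ∪ frontier ends U {z} ω') =
        (W₁ ∪ W₂).erase z ∪ frontier ends U {z} (ω ⊔ ω') := by
      rw [frontier_sup, erase_union_union]
    have h3 : prob p (jEv ends (U \ {z}) s t Vs (A₁ ∪ unionB 𝒰₂) 𝒰₂
        ((W₁.erase z ∪ frontier ends U {z} ω) ∩ (W₂.erase z ∪ frontier ends U {z} ω'))) ≤
        prob p (jEv ends (U \ {z}) s t Vs (A₁ ∪ unionB 𝒰₂) 𝒰₂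
          ((W₁ ∩ W₂).erase z ∪ frontier ends U {z} (ω ⊓ ω'))) :=
      prob_mono hp (jEv_anti_right _ _
        ((Finset.union_subset_union_right (frontier_inf_subset ω ω')).trans
          (erase_inter_subset W₁ W₂ _ _ z)))
    rw [e4] at hIH
    calc weight p ω * prob p (aEv ends (U \ {z}) s t Vs A₁ (W₁.erase z ∪ frontier ends U {z} ω)) *
          (weight p ω' * prob p (bEv ends (U \ {z}) s t Vs 𝒰₂
            (W₂.erase z ∪ frontier ends U {z} ω')))
        = (weight p ω * weight p ω') *
            (prob p (aEv ends (U \ {z}) s t Vs A₁ (W₁.erase z ∪ frontier ends U {z} ω)) *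
              prob p (bEv ends (U \ {z}) s t Vs 𝒰₂ (W₂.erase z ∪ frontier ends U {z} ω'))) := by
          ring
      _ ≤ (weight p ω * weight p ω') *
            (prob p (jEv ends (U \ {z}) s t Vs (A₁ ∪ unionB 𝒰₂) 𝒰₂
                ((W₁ ∩ W₂).erase z ∪ frontier ends U {z} (ω ⊓ ω'))) *
              prob p (mEv ends (U \ {z}) s t Vs (A₁ ∩ unionB 𝒰₂)
                ((W₁ ∪ W₂).erase z ∪ frontier ends U {z} (ω ⊔ ω')))) :=
          mul_le_mul_of_nonneg_left (hIH.trans (mul_le_mul_of_nonneg_right h3 (prob_nonneg hp _)))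
            (mul_nonneg (weight_nonneg hp ω) (weight_nonneg hp ω'))
      _ = weight p (ω ⊓ ω') * prob p (jEv ends (U \ {z}) s t Vs (A₁ ∪ unionB 𝒰₂) 𝒰₂
            ((W₁ ∩ W₂).erase z ∪ frontier ends U {z} (ω ⊓ ω'))) *
          (weight p (ω ⊔ ω') * prob p (mEv ends (U \ {z}) s t Vs (A₁ ∩ unionB 𝒰₂)
            ((W₁ ∪ W₂).erase z ∪ frontier ends U {z} (ω ⊔ ω')))) := by
          rw [← weight_inf_mul_weight_sup p ω ω']
          ring

end Main

end BlockFamily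

end Summit.Ventures.PercRepro2
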